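/-
Copyright (c) 2026 the pub-hodgecm-mathlib formalisation cell (harness21).  Prover seat hodgecm-mathlib-K2E4-p11 (g6), Track B ∕ K2-LIT, h413 = `stmt-HodgeConjecture-24833`,
line `K2_E1_TraceFormulaBeta`, campaign «5Res ENDGAME BY FAMILIES», ROADCARD §3′ (M2 v2), the K-TYPE ⇒ LEVEL reduction (dealer K2E1-plan (g7) deals (233)∕(236)∕(237)), its E1 PRINT: for
`K = K_∞ × K_f` (abelian compact × profinite) mapped continuously into `G(𝔸)`, «`(L²_res)^{(χ, U)}` finite-dimensional for every character `χ` of `K_∞` and open subgroup `U ≤ K_f`» ⟹ the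
`hadm` binder of ★ `residualSpectrumCompact_of_admissible` ⟹ ★ `ResidualSpectrumCompact` (generic `𝒢`; `U(Φ_N)` prints for 5Res ∕ 12R3).
-/
import Summits.HodgeConjecture.HodgeConjecture.Theorems.K2E1KTypeLevelReductionU            -- ★ (233) FILE 2 (this seat): `finiteDimensional_homRangeSum_of_level_finite`
import Summits.HodgeConjecture.HodgeConjecture.Theorems.K2E1ResidualCompactOfAdmissible    -- ★ `residualSpectrumCompact_of_admissible`, `cmResidualSpectrumCompactR_of_admissible`
import HarnessLib

/-!
# K-TYPE ⇒ LEVEL, E1 PRINT — `K2E1ResidualAdmissibleOfLevelFiniteU`: «`dim (L²_res)^{(χ,U)} < ∞` for all characters `χ` of `K_∞` and open `U ≤ K_f`» ⟹ `R(f)|_{L²_res}` compact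
# (generic adelic datum; `U(Φ_N)_{L∕L⁺}` prints: `CmResidualSpectrumCompactR L N μ`, `CmResidualSpectrumCompact L 2 μ`)

Track B ∕ K2-LIT, crux h413 = `stmt-HodgeConjecture-24833`, route of record `HCCMUnconditional`; cell `hodgecm-mathlib`, squad K2, ENGINE E1; dealer K2E1-plan (g7) (236)∕(237): «then its CM
print: `homRangeSum E ≤ (τ, K_f(𝔫))-part` at the CM datum».  THEOREMS ONLY (no `def`, no `instance`, no `notation`, no `sorry`; default heartbeats); lane `--supports
stmt-HodgeConjecture-24833 --as helper` (count-neutral).  The compact group is ABSTRACT `K = T × Kf` — `T` a compact abelian (Hausdorff) group («`K_∞`», in print the compact torus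
`∏_{v∣∞} U(1) × U(1)` of `U(1,1)`), `Kf` a profinite group («`K_{U,f}`», whose open subgroups are cofinal with the principal levels `K_{U,f}(𝔫)` by ★
`UnitaryGroupLevelBasis.nhds_one_hasBasis_finCongruenceLevel`) — with any continuous `ιK : T × Kf →* G(𝔸)`; no concrete maximal compact subgroup is constructed here (that choice, and
the payment of the finiteness hypothesis, belong to D5′ ∕ D6′ ∕ (FIN)).

THE MATHEMATICS ([BorelJacquet1979, §1.2, §4.2]; [MoeglinWaldspurger1995, I.2.17–I.2.18]).  `σ := (L²_res).toContRep.restrict ιK` is a representation of `K = T × Kf` by bounded operators with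
continuous orbit maps (★ `isStronglyContinuous_rightRegular_holds`, ★ `isStronglyContinuous_toContRep_of_isStronglyContinuous`, continuity of `ιK`); `T × 1` is central in `T × Kf`.  By ★ FILE 2
`finiteDimensional_homRangeSum_of_level_finite`, every irreducible finite-dimensional `K`-type `E ≤ L²_res` has its isotypic component inside some
`(L²_res)^{(χ,U)} = (⨅_{u ∈ U} Eig(R(ιK(1,u)); 1)) ⊓ ⨅_t Eig(R(ιK(t,1)); χ t)`, so the finiteness of all these spaces gives the `hadm` binder of ★ `residualSpectrumCompact_of_admissible`
VERBATIM, hence ★ `ResidualSpectrumCompact 𝒢 μ 𝔓`.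
* §1 **`residualSpectrumCompact_of_level_finite`** (generic `𝒢`, any radicals `𝔓`).
* §2 **`cmResidualSpectrumCompactR_of_level_finite`** (`U(Φ_N)`, printed radicals ★ `cmParabolicDataR` — 12R3 reads `N = 3`), **`cmResidualSpectrumCompact_two_of_level_finite`** (`N = 2`, radicals
  ★ `cmParabolicData L 2` — the 5Res reading ★ `CmResidualSpectrumCompact L 2 μ`).
HONEST LABEL: HC_CM is proved only modulo the 7 printed citations (2 remaining named inputs: hLiu418 = `stmt-HodgeConjecture-24832`, h413 = `stmt-HodgeConjecture-24833`) until rung 0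
closes; this file asserts no named fact and closes no socket: the finiteness hypothesis `hfin` («`dim (L²_res)^{(χ,U)} < ∞`», Langlands ∕ (FIN)+D5′) is OPEN in the tree; count-neutral.

## References
* [BorelJacquet1979] A. Borel, H. Jacquet, *Automorphic forms and automorphic representations*, Proc. Symp. Pure Math. 33.1 (1979), §1.2, §4.2.
* [MoeglinWaldspurger1995] C. Mœglin, J.-L. Waldspurger, *Spectral decomposition and Eisenstein series* (1995), I.2.17–I.2.18.
-/

set_option autoImplicit false
set_option linter.dupNamespace false  -- the mandated namespace repeats the summit's segment (`HodgeConjecture.HodgeConjecture`)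

noncomputable section

open MeasureTheory Measure Topology NumberField
open Literature.NumberTheory.Automorphic Literature.NumberTheory.Automorphic.UnitaryGroup AdelicGroupData
open Summit.HodgeConjecture.HodgeConjecture.Cruxes.H413.K2E1CuspidalSpectrumUnitary
open Summit.HodgeConjecture.HodgeConjecture.Cruxes.H413.K2E1ResidualCompactOfAdmissible (residualSpectrumCompact_of_admissible)
open Summit.HodgeConjecture.HodgeConjecture.Cruxes.H413.K2E1KTypeLevelReductionU (finiteDimensional_homRangeSum_of_level_finite)

universe u

namespace Summit.HodgeConjecture.HodgeConjecture.Cruxes.H413.K2E1ResidualAdmissibleOfLevelFiniteU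

/-! ## §1 Generic adelic datum -/

section Generic

variable {F : Type} [Field F] [NumberField F] (𝒢 : AdelicGroupData.{u} F) (μ : Measure 𝒢.automorphicQuotient) [𝒢.IsAutomorphicMeasure μ]
  (𝔓 : 𝒢.ParabolicUnipotentData) [LocallyCompactSpace 𝒢.Adelic]

/-- **`R(f)|_{L²_res}` IS COMPACT IF EVERY `(L²_res)^{(χ,U)}` IS FINITE-DIMENSIONAL** (generic adelic datum).  `T` compact abelian («`K_∞`»), `Kf` profinite («`K_f`»), `ιK : T × Kf →* G(𝔸)`
continuous.  IF for every character `χ : T →* ℂ` and every open subgroup `U ≤ Kf` the space of residual vectors fixed by `ιK(1 × U)` and `χ`-isotypic under `ιK(T × 1)` is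
finite-dimensional, THEN ★ `ResidualSpectrumCompact 𝒢 μ 𝔓` — via ★ FILE 2 (K-type ⇒ level) and ★ `residualSpectrumCompact_of_admissible`. [cite: BorelJacquet1979, §1.2, §4.2]
[cite: MoeglinWaldspurger1995, I.2.17–I.2.18] -/
theorem residualSpectrumCompact_of_level_finite
    {T : Type*} [CommGroup T] [TopologicalSpace T] [IsTopologicalGroup T] [CompactSpace T] [T2Space T]
    {Kf : Type*} [Group Kf] [TopologicalSpace Kf] [IsTopologicalGroup Kf] [CompactSpace Kf] [T2Space Kf] [TotallyDisconnectedSpace Kf]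
    (ιK : T × Kf →* 𝒢.Adelic) (hι : Continuous ιK)
    (hfin : ∀ (χ : T →* ℂ) (U : OpenSubgroup Kf), FiniteDimensional ℂ
      ↥((⨅ u : U, Module.End.eigenspace (((residualSubspace 𝒢 μ 𝔓).toContRep (ιK (1, (u : Kf)))).toLinearMap) 1) ⊓
        ⨅ t : T, Module.End.eigenspace (((residualSubspace 𝒢 μ 𝔓).toContRep (ιK (t, 1))).toLinearMap) (χ t))) :
    ResidualSpectrumCompact 𝒢 μ 𝔓 := by
  set W := residualSubspace 𝒢 μ 𝔓 with hW_def
  have hWc : W.toContRep.IsStronglyContinuous := isStronglyContinuous_toContRep_of_isStronglyContinuous (𝒢.isStronglyContinuous_rightRegular_holds μ) W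
  apply residualSpectrumCompact_of_admissible 𝒢 μ 𝔓 ιK hι
  intro E hE hfd hirr
  haveI := hfd
  refine finiteDimensional_homRangeSum_of_level_finite (W.toContRep.restrict ιK) (MonoidHom.inl T Kf) (fun t k => ?_) (MonoidHom.inr T Kf) (fun v => ?_)
    (fun χ U => ?_) E hE hirr
  · -- `T × 1` is central in `T × Kf`
    obtain ⟨a, b⟩ := k
    rw [MonoidHom.inl_apply, Prod.mk_mul_mk, Prod.mk_mul_mk, one_mul, mul_one, mul_comm]
  · -- continuity of the orbit maps along `Kf`
    have h : Continuous fun k : Kf => ιK (1, k) := hι.comp (continuous_const.prodMk continuous_id)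
    exact (hWc v).comp h
  · exact hfin χ U

end Generic

/-! ## §2 The `U(Φ_N)` prints -/

section Unitary

variable (L : Type) [Field L] [NumberField L] [IsCMField L] (N : ℕ)
  (μ : Measure (cmDatum L N (Matrix.of fun i j : Fin N => if i.val + j.val + 1 = N then (1 : L) else 0)).automorphicQuotient)
  [(cmDatum L N (Matrix.of fun i j : Fin N => if i.val + j.val + 1 = N then (1 : L) else 0)).IsAutomorphicMeasure μ]

/-- **★ `CmResidualSpectrumCompactR L N μ` ⟸ «every `(L²_res)^{(χ,U)}` is finite-dimensional»** (`U(Φ_N)_{L∕L⁺}`, printed radicals ★ `cmParabolicDataR`; `K = T × Kf` abstract compact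
abelian × profinite, `ιK` continuous). [cite: MoeglinWaldspurger1995, I.2.17–I.2.18] [cite: BorelJacquet1979, §4.2] -/
theorem cmResidualSpectrumCompactR_of_level_finite
    {T : Type*} [CommGroup T] [TopologicalSpace T] [IsTopologicalGroup T] [CompactSpace T] [T2Space T]
    {Kf : Type*} [Group Kf] [TopologicalSpace Kf] [IsTopologicalGroup Kf] [CompactSpace Kf] [T2Space Kf] [TotallyDisconnectedSpace Kf]
    (ιK : T × Kf →* (cmDatum L N (Matrix.of fun i j : Fin N => if i.val + j.val + 1 = N then (1 : L) else 0)).Adelic) (hι : Continuous ιK)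
    (hfin : ∀ (χ : T →* ℂ) (U : OpenSubgroup Kf), FiniteDimensional ℂ
      ↥((⨅ u : U, Module.End.eigenspace (((cmResidualSubspaceR L N μ).toContRep (ιK (1, (u : Kf)))).toLinearMap) 1) ⊓
        ⨅ t : T, Module.End.eigenspace (((cmResidualSubspaceR L N μ).toContRep (ιK (t, 1))).toLinearMap) (χ t))) :
    CmResidualSpectrumCompactR L N μ :=
  residualSpectrumCompact_of_level_finite _ μ (cmParabolicDataR L N) ιK hι hfin

end Unitary

section UnitaryTwo

variable (L : Type) [Field L] [NumberField L] [IsCMField L]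
  (μ : Measure (cmDatum L 2 (Matrix.of fun i j : Fin 2 => if i.val + j.val + 1 = 2 then (1 : L) else 0)).automorphicQuotient)
  [(cmDatum L 2 (Matrix.of fun i j : Fin 2 => if i.val + j.val + 1 = 2 then (1 : L) else 0)).IsAutomorphicMeasure μ]

/-- **★ `CmResidualSpectrumCompact L 2 μ` (the 5Res reading) ⟸ «every `(L²_res)^{(χ,U)}` is finite-dimensional»** (`U(1,1)_{L∕L⁺}`, radicals ★ `cmParabolicData L 2`; `K = T × Kf`
abstract compact abelian × profinite — in print `T = ∏_{v∣∞} U(1)×U(1)`, `Kf = K_{U,f}` — with `ιK` continuous). [cite: MoeglinWaldspurger1995, I.2.17–I.2.18] [cite: BorelJacquet1979, §4.2] -/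
theorem cmResidualSpectrumCompact_two_of_level_finite
    {T : Type*} [CommGroup T] [TopologicalSpace T] [IsTopologicalGroup T] [CompactSpace T] [T2Space T]
    {Kf : Type*} [Group Kf] [TopologicalSpace Kf] [IsTopologicalGroup Kf] [CompactSpace Kf] [T2Space Kf] [TotallyDisconnectedSpace Kf]
    (ιK : T × Kf →* (cmDatum L 2 (Matrix.of fun i j : Fin 2 => if i.val + j.val + 1 = 2 then (1 : L) else 0)).Adelic) (hι : Continuous ιK)
    (hfin : ∀ (χ : T →* ℂ) (U : OpenSubgroup Kf), FiniteDimensional ℂ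
      ↥((⨅ u : U, Module.End.eigenspace (((cmResidualSubspace L 2 μ).toContRep (ιK (1, (u : Kf)))).toLinearMap) 1) ⊓
        ⨅ t : T, Module.End.eigenspace (((cmResidualSubspace L 2 μ).toContRep (ιK (t, 1))).toLinearMap) (χ t))) :
    CmResidualSpectrumCompact L 2 μ :=
  residualSpectrumCompact_of_level_finite _ μ (cmParabolicData L 2) ιK hι hfin

end UnitaryTwo

end Summit.HodgeConjecture.HodgeConjecture.Cruxes.H413.K2E1ResidualAdmissibleOfLevelFiniteU

end
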